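import Summits.HubbardSuperconductivity.HubbardSuperconductivity.Theorems.WeakCouplingBCSKlLindhardEnclosureSubst

/-!
# KL-MARGIN-SCAN reader (22) «kernel-lindhard-enclosure» — the CRESCENT MAJORANT and the STRIP LEMMA (abstract form of the hyperbola rule)

The majorised-hyperbola ceiling (`Params.ceilBdry`, variants A/B) bounds the two-shell integrand on a single-straddle cell, strip by
strip, by a one-variable CRESCENT MAJORANT in the cosine `b` of the straddler's substituted coordinate:
`cres true m S V b = 𝟙[m ≤ b]/(S(b − m) + V)` (straddler occupied on the crescent) or `cres false m S V b = 𝟙[b ≤ m]/(S(m − b) + V)`.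
Proved here, with no reference to the kernel: (§1) `cres ≥ 0`, `cres ≤ 1/V`, measurability, integrability on bounded sets; (§2) the
crescent integral `∫_{[A,B]} cres ≤ S⁻¹·log(1 + S·L/V)` once the crescent extent (`B − m`, resp. `m − A`) is `≤ L`; (§3) the **STRIP
LEMMA**: if on `[x0,x1] × [y0,y1]` a non-negative `F` is dominated by `cres up (m x) S V (cos (y + s))`, `τ ≤ |sin (y + s)|`, `cos (y+s)`
stays in `[βlo, βhi]`, `cos` is injective on the shifted interval and the extents are `≤ L`, then
`∫_{x∈[x0,x1]} ∫_{y∈[y0,y1]} F ≤ (x1 − x0) · τ⁻¹ · S⁻¹ · log(1 + S·L/V)` — exactly the shape of the kernel's `vA`/`vB`.  Honest framing: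
elementary analysis; nothing in this file asserts a KL margin at any `t′ ≠ 0`, `K₃`, `U₀`, the window or B1g dominance; a Kohn–Luttinger
instability statement is not ODLRO and nothing here proves superconductivity in the Hubbard model.  (p1 g26, 2026-08-29.)
-/

noncomputable section

set_option linter.dupNamespace false

namespace Summit.HubbardSuperconductivity.HubbardSuperconductivity.Theorems.KlLindhardEnclosure

open Real Set MeasureTheory
open Summit.HubbardSuperconductivity.HubbardSuperconductivity.Theorems

/-! ## §1 The crescent majorant -/

/-- The CRESCENT MAJORANT in the cosine `b` of the substituted coordinate: `up = true`: `𝟙[m ≤ b]/(S(b − m) + V)`;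
`up = false`: `𝟙[b ≤ m]/(S(m − b) + V)`. [folklore] -/
def cres (up : Bool) (m S V b : ℝ) : ℝ :=
  if up then (Ici m).indicator (fun b => 1 / (S * (b - m) + V)) b else (Iic m).indicator (fun b => 1 / (S * (m - b) + V)) b

/-- `0 ≤ cres ≤ 1/V` for `0 ≤ S`, `0 < V`. -/
theorem cres_bounds (up : Bool) {m S V : ℝ} (hS : 0 ≤ S) (hV : 0 < V) (b : ℝ) : 0 ≤ cres up m S V b ∧ cres up m S V b ≤ 1 / V := by
  unfold cres
  cases up <;> simp only [Bool.false_eq_true, ↓reduceIte]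
  · by_cases hb : b ∈ Iic m
    · rw [indicator_of_mem hb]
      have hb' : b ≤ m := hb
      have hden : V ≤ S * (m - b) + V := by nlinarith
      exact ⟨by positivity, one_div_le_one_div_of_le hV hden⟩
    · rw [indicator_of_notMem hb]; exact ⟨le_rfl, by positivity⟩
  · by_cases hb : b ∈ Ici m
    · rw [indicator_of_mem hb]
      have hb' : m ≤ b := hb
      have hden : V ≤ S * (b - m) + V := by nlinarith
      exact ⟨by positivity, one_div_le_one_div_of_le hV hden⟩
    · rw [indicator_of_notMem hb]; exact ⟨le_rfl, by positivity⟩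

/-- The crescent majorant is measurable in `b`. -/
theorem measurable_cres (up : Bool) (m S V : ℝ) : Measurable (cres up m S V) := by
  unfold cres
  cases up <;> simp only [Bool.false_eq_true, ↓reduceIte]
  · exact (Measurable.indicator (by fun_prop) measurableSet_Iic)
  · exact (Measurable.indicator (by fun_prop) measurableSet_Ici)

/-- The crescent majorant (composed with any measurable map) is integrable on a set of finite measure. -/
theorem integrableOn_cres_comp (up : Bool) {m S V : ℝ} (hS : 0 ≤ S) (hV : 0 < V) {φ : ℝ → ℝ} (hφ : Measurable φ)
    {s : Set ℝ} (hs : volume s < ⊤) : IntegrableOn (fun y => cres up m S V (φ y)) s volume :=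
  Measure.integrableOn_of_bounded hs.ne ((measurable_cres up m S V).comp hφ).aestronglyMeasurable
    (Filter.Eventually.of_forall fun y => by
      rw [Real.norm_of_nonneg (cres_bounds up hS hV _).1]; exact (cres_bounds up hS hV _).2)

/-! ## §2 The crescent integral -/

/-- **CRESCENT INTEGRAL, occupied side**: `∫_{[A,B]} 𝟙[m ≤ b]/(S(b−m)+V) ≤ S⁻¹ log(1 + S L/V)` when `B − m ≤ L`, `0 ≤ L`. -/
theorem setIntegral_cres_up_le {A B m S V L : ℝ} (hS : 0 < S) (hV : 0 < V) (hL : 0 ≤ L) (hext : B - m ≤ L) :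
    ∫ b in Icc A B, cres true m S V b ≤ S⁻¹ * Real.log (1 + S * L / V) := by
  have hlog : 0 ≤ S⁻¹ * Real.log (1 + S * L / V) := by
    have : 0 ≤ S * L / V := by positivity
    exact mul_nonneg (inv_nonneg.mpr hS.le) (Real.log_nonneg (by linarith))
  simp only [cres, ↓reduceIte]
  rw [setIntegral_indicator measurableSet_Ici]
  by_cases hmB : m ≤ B
  · have hsub : Icc A B ∩ Ici m ⊆ Icc m B := fun b hb => ⟨hb.2, hb.1.2⟩
    have hint : IntegrableOn (fun b => 1 / (S * (b - m) + V)) (Icc m B) volume := by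
      apply ContinuousOn.integrableOn_Icc
      apply ContinuousOn.div continuousOn_const (by fun_prop)
      intro b hb; have : m ≤ b := hb.1; nlinarith
    have hnn : ∀ b ∈ Icc m B, 0 ≤ 1 / (S * (b - m) + V) := fun b hb => by have : m ≤ b := hb.1; positivity
    calc ∫ b in Icc A B ∩ Ici m, 1 / (S * (b - m) + V)
        ≤ ∫ b in Icc m B, 1 / (S * (b - m) + V) :=
          setIntegral_mono_set hint (ae_restrict_of_forall_mem measurableSet_Icc hnn) (Filter.Eventually.of_forall hsub)
      _ = ∫ b in m..B, 1 / (S * (b - m) + V) := by rw [intervalIntegral.integral_of_le hmB, integral_Icc_eq_integral_Ioc]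
      _ ≤ S⁻¹ * Real.log (1 + S * L / V) := integral_inv_affine_le hS hV hmB hext
  · push Not at hmB
    have : Icc A B ∩ Ici m = ∅ := by
      ext b; simp only [mem_inter_iff, mem_Icc, mem_Ici, mem_empty_iff_false, iff_false, not_and]; intro h; linarith [h.2]
    rw [this, Measure.restrict_empty, integral_zero_measure]
    exact hlog

/-- **CRESCENT INTEGRAL, empty side**: `∫_{[A,B]} 𝟙[b ≤ m]/(S(m−b)+V) ≤ S⁻¹ log(1 + S L/V)` when `m − A ≤ L`, `0 ≤ L`. -/
theorem setIntegral_cres_dn_le {A B m S V L : ℝ} (hS : 0 < S) (hV : 0 < V) (hL : 0 ≤ L) (hext : m - A ≤ L) :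
    ∫ b in Icc A B, cres false m S V b ≤ S⁻¹ * Real.log (1 + S * L / V) := by
  have hlog : 0 ≤ S⁻¹ * Real.log (1 + S * L / V) := by
    have : 0 ≤ S * L / V := by positivity
    exact mul_nonneg (inv_nonneg.mpr hS.le) (Real.log_nonneg (by linarith))
  simp only [cres, Bool.false_eq_true, ↓reduceIte]
  rw [setIntegral_indicator measurableSet_Iic]
  by_cases hAm : A ≤ m
  · have hsub : Icc A B ∩ Iic m ⊆ Icc A m := fun b hb => ⟨hb.1.1, hb.2⟩
    have hint : IntegrableOn (fun b => 1 / (S * (m - b) + V)) (Icc A m) volume := by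
      apply ContinuousOn.integrableOn_Icc
      apply ContinuousOn.div continuousOn_const (by fun_prop)
      intro b hb; have : b ≤ m := hb.2; nlinarith
    have hnn : ∀ b ∈ Icc A m, 0 ≤ 1 / (S * (m - b) + V) := fun b hb => by have : b ≤ m := hb.2; positivity
    -- reflect b ↦ −b to reuse the occupied-side integral
    have hrefl : ∫ b in A..m, 1 / (S * (m - b) + V) = ∫ u in (-m)..(-A), 1 / (S * (u - (-m)) + V) := by
      rw [show (fun b => 1 / (S * (m - b) + V)) = fun b => (fun u => 1 / (S * (u - (-m)) + V)) (-b) by funext b; ring_nf]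
      rw [intervalIntegral.integral_comp_neg (fun u => 1 / (S * (u - (-m)) + V))]
    calc ∫ b in Icc A B ∩ Iic m, 1 / (S * (m - b) + V)
        ≤ ∫ b in Icc A m, 1 / (S * (m - b) + V) :=
          setIntegral_mono_set hint (ae_restrict_of_forall_mem measurableSet_Icc hnn) (Filter.Eventually.of_forall hsub)
      _ = ∫ b in A..m, 1 / (S * (m - b) + V) := by rw [intervalIntegral.integral_of_le hAm, integral_Icc_eq_integral_Ioc]
      _ = ∫ u in (-m)..(-A), 1 / (S * (u - (-m)) + V) := hrefl
      _ ≤ S⁻¹ * Real.log (1 + S * L / V) := integral_inv_affine_le hS hV (by linarith) (by linarith)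
  · push Not at hAm
    have : Icc A B ∩ Iic m = ∅ := by
      ext b; simp only [mem_inter_iff, mem_Icc, mem_Iic, mem_empty_iff_false, iff_false, not_and]; intro h; linarith [h.1]
    rw [this, Measure.restrict_empty, integral_zero_measure]
    exact hlog

/-- The crescent extent predicate, by orientation: `up`: `βhi − m ≤ L`; `down`: `m − βlo ≤ L`. [folklore] -/
def cresExtentLE (up : Bool) (m βlo βhi L : ℝ) : Prop := if up then βhi - m ≤ L else m - βlo ≤ L

/-- Both orientations at once. -/
theorem setIntegral_cres_le (up : Bool) {A B m S V L : ℝ} (hS : 0 < S) (hV : 0 < V) (hL : 0 ≤ L)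
    (hext : cresExtentLE up m A B L) : ∫ b in Icc A B, cres up m S V b ≤ S⁻¹ * Real.log (1 + S * L / V) := by
  cases up with
  | true => exact setIntegral_cres_up_le hS hV hL (by simpa [cresExtentLE] using hext)
  | false => exact setIntegral_cres_dn_le hS hV hL (by simpa [cresExtentLE] using hext)

/-! ## §3 The strip lemma -/

/-- **ONE STRIP**: on `[y0, y1]`, an integrable `f` dominated by `cres up m S V (cos (y + s))`, with `τ ≤ |sin (y + s)|`,
`cos (y + s) ∈ [βlo, βhi]`, `cos` injective on `[y0 + s, y1 + s]` and extent `≤ L`, has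
`∫_{[y0,y1]} f ≤ τ⁻¹ · S⁻¹ · log(1 + S L/V)`. -/
theorem strip_inner_le (up : Bool) {y0 y1 s τ m S V L βlo βhi : ℝ} (hy : y0 ≤ y1) (hτ : 0 < τ) (hS : 0 < S) (hV : 0 < V)
    (hL : 0 ≤ L) (hsin : ∀ y ∈ Icc y0 y1, τ ≤ |Real.sin (y + s)|)
    (hcos : ∀ y ∈ Icc y0 y1, βlo ≤ Real.cos (y + s) ∧ Real.cos (y + s) ≤ βhi)
    (hinj : InjOn Real.cos (Icc (y0 + s) (y1 + s))) (hext : cresExtentLE up m βlo βhi L)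
    {f : ℝ → ℝ} (hfi : IntegrableOn f (Icc y0 y1) volume)
    (hdom : ∀ y ∈ Icc y0 y1, f y ≤ cres up m S V (Real.cos (y + s))) :
    ∫ y in Icc y0 y1, f y ≤ τ⁻¹ * (S⁻¹ * Real.log (1 + S * L / V)) := by
  -- (1) dominate by the crescent majorant
  have hci : IntegrableOn (fun y => cres up m S V (Real.cos (y + s))) (Icc y0 y1) volume :=
    integrableOn_cres_comp up hS.le hV (by fun_prop) measure_Icc_lt_top
  have h1 : ∫ y in Icc y0 y1, f y ≤ ∫ y in Icc y0 y1, cres up m S V (Real.cos (y + s)) :=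
    setIntegral_mono_on hfi hci measurableSet_Icc hdom
  -- (2) translate by `s`
  have h2 : (∫ y in Icc y0 y1, cres up m S V (Real.cos (y + s))) = ∫ y in Icc (y0 + s) (y1 + s), cres up m S V (Real.cos y) := by
    rw [integral_Icc_eq_integral_Ioc, integral_Icc_eq_integral_Ioc, ← intervalIntegral.integral_of_le hy,
      ← intervalIntegral.integral_of_le (by linarith), intervalIntegral.integral_comp_add_right (fun y => cres up m S V (Real.cos y)) s]
  -- (3) substitute `b = cos y`
  have hsin' : ∀ y ∈ Icc (y0 + s) (y1 + s), τ ≤ |Real.sin y| := by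
    intro y hy; have := hsin (y - s) ⟨by linarith [hy.1], by linarith [hy.2]⟩; simpa using this
  have hcos' : ∀ y ∈ Icc (y0 + s) (y1 + s), βlo ≤ Real.cos y ∧ Real.cos y ≤ βhi := by
    intro y hy; have := hcos (y - s) ⟨by linarith [hy.1], by linarith [hy.2]⟩; simpa using this
  have hci' : IntegrableOn (fun y => cres up m S V (Real.cos y)) (Icc (y0 + s) (y1 + s)) volume :=
    integrableOn_cres_comp up hS.le hV Real.measurable_cos measure_Icc_lt_top
  have h3 := setIntegral_comp_cos_le hτ hinj hsin' (fun b => (cres_bounds up hS.le hV b).1) hci'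
  -- (4) enlarge the `b`-range to the outer range and integrate the crescent
  have hsub := cos_image_subset_Icc hcos'
  have hcI : IntegrableOn (cres up m S V) (Icc βlo βhi) volume :=
    integrableOn_cres_comp up hS.le hV measurable_id measure_Icc_lt_top
  have h4 := setIntegral_mono_of_subset_nonneg hsub (fun b => (cres_bounds up hS.le hV b).1) hcI
  have h5 := setIntegral_cres_le up hS hV hL hext
  calc ∫ y in Icc y0 y1, f y ≤ ∫ y in Icc (y0 + s) (y1 + s), cres up m S V (Real.cos y) := h1.trans (le_of_eq h2)
    _ ≤ τ⁻¹ * ∫ b in Real.cos '' Icc (y0 + s) (y1 + s), cres up m S V b := h3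
    _ ≤ τ⁻¹ * (S⁻¹ * Real.log (1 + S * L / V)) := by
        exact mul_le_mul_of_nonneg_left (h4.trans h5) (inv_nonneg.mpr hτ.le)

/-- **THE STRIP LEMMA**: `∫_{x∈[x0,x1]} ∫_{y∈[y0,y1]} F ≤ (x1 − x0)·τ⁻¹·S⁻¹·log(1 + S L/V)` under strip-wise domination by the crescent
majorant (the crescent position `m x` may depend on `x`; everything else is uniform). -/
theorem strip_lemma (up : Bool) {x0 x1 y0 y1 s τ S V L βlo βhi : ℝ} {m : ℝ → ℝ} (hx : x0 ≤ x1) (hy : y0 ≤ y1) (hτ : 0 < τ)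
    (hS : 0 < S) (hV : 0 < V) (hL : 0 ≤ L) (hsin : ∀ y ∈ Icc y0 y1, τ ≤ |Real.sin (y + s)|)
    (hcos : ∀ y ∈ Icc y0 y1, βlo ≤ Real.cos (y + s) ∧ Real.cos (y + s) ≤ βhi)
    (hinj : InjOn Real.cos (Icc (y0 + s) (y1 + s))) (hext : ∀ x ∈ Icc x0 x1, cresExtentLE up (m x) βlo βhi L)
    {F : ℝ → ℝ → ℝ} (hF0 : ∀ x ∈ Icc x0 x1, ∀ y ∈ Icc y0 y1, 0 ≤ F x y)
    (hFi : ∀ x ∈ Icc x0 x1, IntegrableOn (F x) (Icc y0 y1) volume)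
    (hdom : ∀ x ∈ Icc x0 x1, ∀ y ∈ Icc y0 y1, F x y ≤ cres up (m x) S V (Real.cos (y + s))) :
    ∫ x in Icc x0 x1, ∫ y in Icc y0 y1, F x y ≤ (x1 - x0) * (τ⁻¹ * (S⁻¹ * Real.log (1 + S * L / V))) := by
  have hK : ∀ x ∈ Icc x0 x1, ‖∫ y in Icc y0 y1, F x y‖ ≤ τ⁻¹ * (S⁻¹ * Real.log (1 + S * L / V)) := by
    intro x hx
    rw [Real.norm_of_nonneg (setIntegral_nonneg measurableSet_Icc (hF0 x hx))]
    exact strip_inner_le up hy hτ hS hV hL hsin hcos hinj (hext x hx) (hFi x hx) (hdom x hx)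
  have h := norm_setIntegral_le_of_norm_le_const (measure_Icc_lt_top : volume (Icc x0 x1) < ⊤) hK
  rw [Real.norm_of_nonneg (setIntegral_nonneg measurableSet_Icc fun x hx => setIntegral_nonneg measurableSet_Icc (hF0 x hx)),
    Real.volume_real_Icc_of_le hx] at h
  linarith

end Summit.HubbardSuperconductivity.HubbardSuperconductivity.Theorems.KlLindhardEnclosure

end
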